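import Summits.SmoothPoincare4.SmoothPoincare4.Theses.SymplecticOrigami
import Summits.SmoothPoincare4.SmoothPoincare4.Theorems.OrigamiFoldExistence.Negative.ZeroSlack
import Literature.Geometry.Symplectic.SteinTwoHandles
import Literature.Geometry.Symplectic.SteinFillingSphere
import Literature.Geometry.Symplectic.SteinHandlebodies
import Literature.Geometry.Symplectic.TwoHandleIsotopyHolds
import Literature.Topology.FourManifolds.HomotopySpheres
import Literature.Topology.FourManifolds.Morse
import Literature.Topology.FourManifolds.Handles
import Literature.Topology.FourManifolds.HomotopyS4CompactProofs
import Literature.Topology.FourManifolds.HomotopyS4OrientableProofs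
import Summits.SmoothPoincare4.SmoothPoincare4.Theorems.SymplecticOrigamiOrigamiFoldExistenceStubCertifiedFakeBallStandard
import Summits.SmoothPoincare4.SmoothPoincare4.Theorems.SymplecticOrigamiOrigamiFoldExistenceStubKirbyFakeBall

/-!
# Skeleton line `bennequin-defect-certificates` for crux `OrigamiFoldExistence` (stmt-SmoothPoincare4-7844)

Route `SymplecticOrigami`, crux r4 `OrigamiFoldExistence` (E, zero slack modulo R, D, RS:
`Negative.ZeroSlackSharp`).  Idea card `Ideas/bennequin-defect-certificates.md` (crux-ideate r2,
ideator 4; triage r2-1/r2-2/r2-3: pass ×3 with four concurring sharpenings, all acted on below).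

THE LINE.  Attack E through its own endpoint "the fake ball `Δ = Σ ∖ e(B̊⁴)` is a convex/Stein
filling of `S³`" by the ONE constructive engine symplectic topology has for Stein-ness, the
Eliashberg–Gompf criterion: a 2-handlebody `W₀ ∪ 2-handles` is Stein as soon as the attaching link
is LEGENDRIAN in `∂W₀` (for a Stein structure on the 1-handlebody `W₀`) with every handle framing
equal to the contact framing minus one (twisting `-1`, Akbulut–Matveyev defect `0`).  Then
`Δ` Stein `⇒ Δ ≅ 𝔻⁴` (Eliashberg 1990 Thm 5.1) `⇒ Σ = 𝔻⁴ ∪ 𝔻⁴` twisted sphere `⇒ Σ ≅ S⁴`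
(Cerf `Γ₄ = 0`) `⇒` E by transport of the fold data of the round sphere.

STUBS (6; the composition `OrigamiFoldExistence_of` is kernel-checked, sorries only in `stub_*`;
lead revision r2, 2026-08-17 seat a1: STUB 2 and STUB 4 CLOSED by the tree theorems p137252 / p136483,
sorries 6 → 4; STUB 3 (apex) REFUTED on paper at S = S⁴ — see `Lines/bennequin-defect-certificates.dead.md`):
* `stub_noOneHandles` [SCOPE; VERBATIM crux `NoohNoOneHandles` of route NoOneHandles, stmt-0378 —
  staffed once, shared with line round-trace-continuity]: every homotopy 4-sphere has a Morse
  function without index-1 critical points (dually: is 3-handle-free).  The scope is FORCED, not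
  chosen: a Stein domain is a 2-handlebody (tree theorem `IsSteinDomain.isHandlebodyOfIndexLE_two`).
* `stub_kirbyFakeBall` [Morse ⇒ Kirby; known, formal L–XL]: then some fake ball `Δ = Σ ∖ e(B̊⁴)`
  (typed EXTRINSICALLY: `e : ℝ⁴ ↪ Σ`, `j : Δ ↪ Σ` smooth embeddings, `range j = (e B̊⁴)ᶜ`,
  `j(∂Δ) = e(S³)`) is PRESENTED as a Kirby diagram: a compact orientable 1-handlebody `W₀` and a
  finite multi-attachment `h₀` of 2-handles with `Δ = W₀ ∪_{h₀} 2-handles` (`IsMultiAttachment`).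
* `stub_legendrianNormalForm` [APEX, hardest; the presentation-relative K1 of the card, typed as
  the triage panel asked]: for THAT diagram there are a Stein structure `T` on `W₀` and a framed
  isotopy through links in `∂W₀` of the attaching framed link to a `T`-Legendrian link all of whose
  carried framings have twisting `-1` — a LEGENDRIAN (Eliashberg–Gompf) NORMAL FORM of the given
  diagram, reached by isotopy alone (no slide, no birth, no cancellation: the underlying balanced
  presentation of the trivial group is untouched).
* `stub_certifiedFakeBallStandard` [certificate ⇒ standard; known modulo the named facts it takes
  as antecedents, formal L]: under Eliashberg's theorem part II (E2), Eliashberg's filling theorem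
  (EL) and Cerf's `Γ₄ = 0` (route item `CerfGammaFour`), a homotopy 4-sphere whose fake ball is
  `W₀ ∪` Legendrian 2-handles of twisting `-1` is diffeomorphic to `S⁴`.
* `stub_eliashbergTwoHandles` (E2 = `Literature.Geometry.Symplectic.Gompf1998_thm13_twoHandles`) and
  `stub_eliashbergSteinFillingSphere` (EL = `…Eliashberg1990_steinFilling_sphere_three`) [NAMED
  LITERATURE FACTS, registered as needs-fact markers exactly as `stub_lawsonMichelsohn1984` of line
  round-trace-continuity: each closes by `exact …_holds` the day the Literature discharges it].
The composition threads the PROVED isotopy-invariance of 2-handle attachment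
(`HandleAttachingMap.isMultiAttachment_of_linkIsotopyInBoundary_holds`, ISO) between the apex and
the certificate stub, the PROVED packaging facts (homotopy `S⁴` ⇒ compact, orientable) and the
PROVED transport `Negative.foldData_transport` with the route item `RoundSphereIsOrigamiFold`.

HONESTY (zero slack located, Disproof §2): modulo the known stubs,
`stub_legendrianNormalForm ⟺ [every 3-handle-free homotopy 4-sphere is S⁴] ∧ Q`, where
`Q` := the apex on diagrams of the GENUINE ball (its `S⁴`-instance): "every 2-handlebody diagram
of `B⁴` is framed-isotopic, in the boundary of its 1-handlebody, to a Stein (Legendrian, `tb - 1`)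
diagram".  `Q` is OPEN and exotica-free; `k ≤ 1` one-handles is a theorem (Gabai's Property R +
light bulb + Legendrian realisation/stabilisation); `k = 2` contains the Akbulut–Kirby ball
diagrams.  DICHOTOMY (triage r2-2 (iii), r2-3 (2)): a certificate makes the GIVEN handle structure
of `B⁴` Stein; a Stein homotopy in complex dimension 2 passes only through handles of index `≤ 2`,
hence through Andrews–Curtis moves of the spine presentation; so `Q ∧ [Stein structures on B⁴ are
unique up to Stein homotopy]` ⇒ every spine presentation of a 2-handlebody structure on `B⁴`
(e.g. AK(4) = ⟨x, y ∣ xyx = yxy, x⁵ = y⁴⟩, Gompf 1991) is AC-trivial.  Neither Stein-homotopy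
uniqueness on `B⁴` (only diffeomorphism / symplectic-deformation uniqueness of fillings of `S³` is
in print: Eliashberg 1990 Thm 5.1, McDuff 1990 Thm 1.7, Wendl 2020 Cor 5.7) nor AC-nontriviality of
AK(n) is known; the line BETS on exotic Stein homotopy classes on `B⁴` realising AC-nontrivial
spines (a certificate found on AK(4)'s ball diagram is news either way).  Allowing handle slides
would NOT evade the dichotomy (the AC class is slide-invariant), so nothing is lost by typing the
apex with isotopies only — and isotopy is typable today (`LinkIsotopyInBoundary`, `IsFramingAlong`).

Disproof used (Disproof.lean v6): `crux_false_without_homotopyEquiv` (§1.1) and the Kervaire test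
(§7b) are honoured BY TYPE — every stub past the scope quantifies over `S : HomotopySphere 4` and
its fake ball, and Kervaire's `Δ_K` / `M_K` is not a `HomotopySphere`; the `b₂`-bench of §9.1–9.2
(`(S² × S²)°`, the crease that killed `PATHWithoutFakeBall`) is outside the apex's hypotheses (it is
not the fake ball of a homotopy sphere) AND is rejected by the mechanism with the right sign (it is
not Stein at all: a Stein domain with `S³` boundary is `𝔻⁴`, EL); zero slack §2 is conceded and
located (above); no landed `Negative/` lemma concerns Legendrian presentations (checked:
`Negative/{ZeroSlack,ZeroSlackSharp,LoadBearing,Disconnected,CreaseModels,MeanConvexUnwindingCreaseGerm,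
RealProjectiveNotOrientable}`), so no stub is an instance of a refuted statement.
`ledger negatives --problem SmoothPoincare4`: none bearing on Stein/Legendrian statements.
-/

noncomputable section

-- the prescribed namespace `Summit.<P>.<Sub>.…` duplicates `SmoothPoincare4` (P = Sub)
set_option linter.dupNamespace false

open scoped Manifold ContDiff Topology
open Set Function TopologicalSpace ContinuousMap
open Literature.Topology.FourManifolds (HomotopySphere HandleAttachingMap IsHandlebodyOfIndexLE)
open Literature.Geometry.Symplectic (SteinStructure IsLegendrianKnot LinkIsotopyInBoundary
  IsFramingAlong FramingHomotopic Gompf1998_thm13_twoHandles Eliashberg1990_steinFilling_sphere_three)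
open Summit.SmoothPoincare4.SmoothPoincare4.Theses.SymplecticOrigami (OrigamiFoldExistence
  RoundSphereIsOrigamiFold CerfGammaFour)

namespace Summit.SmoothPoincare4.SmoothPoincare4.Cruxes.OrigamiFoldExistence.BennequinDefectCertificates

/-- Local notation: the model space `ℝ⁴`. -/
local notation "E4" => EuclideanSpace ℝ (Fin 4)

/-- Local notation: the round 4-sphere with Mathlib's smooth structure. -/
local notation "𝕊⁴" => (Metric.sphere (0 : EuclideanSpace ℝ (Fin 5)) 1)

/-- Local notation: the unit circle (domain of attaching circles). -/
local notation "𝕊¹" => (Metric.sphere (0 : EuclideanSpace ℝ (Fin 2)) 1)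

/-! ### Vocabulary (one abbreviation; it is INLINED in every registered signature so that the
Theorems-side stub files, which cannot import this Cruxes file, restate the stubs verbatim) -/

/-- `(e, Δ, j)` presents `Δ` as THE FAKE BALL of the homotopy 4-sphere `S` cut out by the ball
`e`: `e : ℝ⁴ → S` and `j : Δ → S` are smooth embeddings (`Δ` an abstract compact 4-manifold with
boundary), `j(Δ) = S ∖ e(B̊⁴)` and `j(∂Δ) = e(S³)` (the boundary clause is recorded explicitly, as
for `HandleAttachingMap`, since smooth invariance of domain for embeddings of manifolds with
boundary is not in the tree; it holds automatically).  Every compact contractible `Δ` with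
`∂Δ ≅ S³` arises this way from the homotopy sphere `Δ ∪ 𝔻⁴`, so nothing is lost, and the
hypothesis `S : HomotopySphere 4` is exactly where `M ≃ₕ S⁴` is consumed (Disproof §1.1, §7b). -/
def IsFakeBallOf (S : HomotopySphere 4) (e : E4 → S.carrier) (Δ : Type) [TopologicalSpace Δ]
    [ChartedSpace (EuclideanHalfSpace 4) Δ] (j : Δ → S.carrier) : Prop :=
  Manifold.IsSmoothEmbedding (𝓡 4) (𝓡 4) ∞ e ∧ Manifold.IsSmoothEmbedding (𝓡∂ 4) (𝓡 4) ∞ j ∧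
    Set.range j = (e '' Metric.ball (0 : E4) 1)ᶜ ∧
    j '' ((𝓡∂ 4).boundary Δ) = e '' Metric.sphere (0 : E4) 1

/-! ### The six stub STATEMENTS (named `Prop`s; the registered `stub_*` theorems below restate them
verbatim with `IsFakeBallOf` inlined, and `Registered.stub_*` are their name-keyed aliases used as
the hypotheses of `OrigamiFoldExistence_of` — the skeleton audit admits hypotheses BY NAME; same
device as `Lines/round-trace-continuity.lean`) -/

/-- Statement of STUB 1 [scope: no 1-handles; = `NoohNoOneHandles` of route NoOneHandles,
stmt-SmoothPoincare4-0378, VERBATIM]. -/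
def NoOneHandles : Prop :=
  ∀ S : Literature.Topology.FourManifolds.HomotopySphere 4, ∃ f : S.carrier → ℝ,
    Literature.Topology.FourManifolds.IsMorse (𝓡 4) f ∧
      Literature.Topology.FourManifolds.criticalSetOfIndex (𝓡 4) f 1 = ∅

/-- Statement of STUB 2 [Morse ⇒ Kirby-presented fake ball]. -/
def KirbyFakeBall : Prop :=
  ∀ S : Literature.Topology.FourManifolds.HomotopySphere 4,
    (∃ f : S.carrier → ℝ, Literature.Topology.FourManifolds.IsMorse (𝓡 4) f ∧
        Literature.Topology.FourManifolds.criticalSetOfIndex (𝓡 4) f 1 = ∅) →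
    ∃ (e : EuclideanSpace ℝ (Fin 4) → S.carrier) (Δ : Type) (_ : TopologicalSpace Δ) (_ : T2Space Δ)
      (_ : SecondCountableTopology Δ) (_ : ChartedSpace (EuclideanHalfSpace 4) Δ)
      (_ : IsManifold (𝓡∂ 4) ∞ Δ) (_ : CompactSpace Δ) (j : Δ → S.carrier)
      (W₀ : Type) (_ : TopologicalSpace W₀) (_ : T2Space W₀) (_ : SecondCountableTopology W₀)
      (_ : ChartedSpace (EuclideanHalfSpace 4) W₀) (_ : IsManifold (𝓡∂ 4) ∞ W₀) (_ : CompactSpace W₀)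
      (ι : Type) (_ : Finite ι) (h₀ : ι → Literature.Topology.FourManifolds.HandleAttachingMap 3 2 W₀),
      (Manifold.IsSmoothEmbedding (𝓡 4) (𝓡 4) ∞ e ∧ Manifold.IsSmoothEmbedding (𝓡∂ 4) (𝓡 4) ∞ j ∧
        Set.range j = (e '' Metric.ball (0 : EuclideanSpace ℝ (Fin 4)) 1)ᶜ ∧
        j '' ((𝓡∂ 4).boundary Δ) = e '' Metric.sphere (0 : EuclideanSpace ℝ (Fin 4)) 1) ∧
      Literature.Topology.FourManifolds.IsOrientable (𝓡∂ 4) W₀ ∧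
      Literature.Topology.FourManifolds.IsHandlebodyOfIndexLE 3 1 W₀ ∧
      Literature.Topology.FourManifolds.HandleAttachingMap.IsMultiAttachment h₀ (𝓡∂ 4) Δ

/-- Statement of STUB 3 [APEX: Legendrian normal form of fake-ball diagrams, by framed isotopy]. -/
def LegendrianNormalForm : Prop :=
  ∀ (S : Literature.Topology.FourManifolds.HomotopySphere 4) (e : EuclideanSpace ℝ (Fin 4) → S.carrier)
    (Δ : Type) [TopologicalSpace Δ] [T2Space Δ] [SecondCountableTopology Δ]
    [ChartedSpace (EuclideanHalfSpace 4) Δ] [IsManifold (𝓡∂ 4) ∞ Δ] [CompactSpace Δ] (j : Δ → S.carrier)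
    (W₀ : Type) [TopologicalSpace W₀] [T2Space W₀] [SecondCountableTopology W₀]
    [ChartedSpace (EuclideanHalfSpace 4) W₀] [IsManifold (𝓡∂ 4) ∞ W₀] [CompactSpace W₀]
    (ι : Type) [Finite ι] (h₀ : ι → Literature.Topology.FourManifolds.HandleAttachingMap 3 2 W₀),
    (Manifold.IsSmoothEmbedding (𝓡 4) (𝓡 4) ∞ e ∧ Manifold.IsSmoothEmbedding (𝓡∂ 4) (𝓡 4) ∞ j ∧
        Set.range j = (e '' Metric.ball (0 : EuclideanSpace ℝ (Fin 4)) 1)ᶜ ∧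
        j '' ((𝓡∂ 4).boundary Δ) = e '' Metric.sphere (0 : EuclideanSpace ℝ (Fin 4)) 1) →
    Literature.Topology.FourManifolds.IsOrientable (𝓡∂ 4) W₀ →
    Literature.Topology.FourManifolds.IsHandlebodyOfIndexLE 3 1 W₀ →
    Literature.Topology.FourManifolds.HandleAttachingMap.IsMultiAttachment h₀ (𝓡∂ 4) Δ →
    ∃ (T : Literature.Geometry.Symplectic.SteinStructure W₀)
      (h : ι → Literature.Topology.FourManifolds.HandleAttachingMap 3 2 W₀)
      (Φ : Literature.Geometry.Symplectic.LinkIsotopyInBoundary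
        (fun i => (h₀ i).attachingCircle) fun i => (h i).attachingCircle)
      (νt : ι → ℝ → (Metric.sphere (0 : EuclideanSpace ℝ (Fin 2)) 1) → EuclideanSpace ℝ (Fin 4)),
      (∀ i, Literature.Geometry.Symplectic.IsFramingAlong (Φ.isotopy i) (h₀ i).attachingFraming (νt i)) ∧
      (∀ i, Literature.Geometry.Symplectic.FramingHomotopic (h i).attachingCircle (νt i 1)
        (h i).attachingFraming) ∧
      (Pairwise fun i i' => Disjoint (Set.range (h i).toFun) (Set.range (h i').toFun)) ∧
      (∀ i, Literature.Geometry.Symplectic.IsLegendrianKnot T.J (h i).attachingCircle) ∧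
      (∀ i, T.twisting (h i).attachingCircle (h i).attachingFraming = -1)

/-- Cerf's theorem `Γ₄ = 0` in twisted-sphere form — VERBATIM the body of the route item `CerfGammaFour`
(stmt-SmoothPoincare4-8758) and of the named fact `Literature.Topology.FourManifolds.cerf_twistedSphere_four`
(antecedent of STUB 4, supplied in the composition by the route item, by name). -/
def CerfTwistedSphereFour : Prop :=
  ∀ [Fact (Literature.Topology.FourManifolds.isSmoothEmbedding_sphereInclusion' 3)] (φ : (Metric.sphere (0 : EuclideanSpace ℝ (Fin 4)) 1) ≃ₘ⟮𝓡 3, 𝓡 3⟯ (Metric.sphere (0 : EuclideanSpace ℝ (Fin 4)) 1)) (T : Literature.Topology.FourManifolds.TwistedSphere 3 φ), Nonempty (T.carrier ≃ₘ⟮𝓡 4, 𝓡 4⟯ Metric.sphere (0 : EuclideanSpace ℝ (Fin 5)) 1)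

/-- Statement of STUB 4 [certificate ⇒ standard, UNDER E2, EL and Γ₄ = 0]. -/
def CertifiedFakeBallStandard : Prop :=
  Literature.Geometry.Symplectic.Gompf1998_thm13_twoHandles →
  Literature.Geometry.Symplectic.Eliashberg1990_steinFilling_sphere_three →
  (∀ [Fact (Literature.Topology.FourManifolds.isSmoothEmbedding_sphereInclusion' 3)] (φ : (Metric.sphere (0 : EuclideanSpace ℝ (Fin 4)) 1) ≃ₘ⟮𝓡 3, 𝓡 3⟯ (Metric.sphere (0 : EuclideanSpace ℝ (Fin 4)) 1)) (T : Literature.Topology.FourManifolds.TwistedSphere 3 φ), Nonempty (T.carrier ≃ₘ⟮𝓡 4, 𝓡 4⟯ Metric.sphere (0 : EuclideanSpace ℝ (Fin 5)) 1)) →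
  ∀ (S : Literature.Topology.FourManifolds.HomotopySphere 4) (e : EuclideanSpace ℝ (Fin 4) → S.carrier)
    (Δ : Type) [TopologicalSpace Δ] [T2Space Δ] [SecondCountableTopology Δ]
    [ChartedSpace (EuclideanHalfSpace 4) Δ] [IsManifold (𝓡∂ 4) ∞ Δ] [CompactSpace Δ] (j : Δ → S.carrier)
    (W₀ : Type) [TopologicalSpace W₀] [T2Space W₀] [SecondCountableTopology W₀]
    [ChartedSpace (EuclideanHalfSpace 4) W₀] [IsManifold (𝓡∂ 4) ∞ W₀] [CompactSpace W₀]
    (T : Literature.Geometry.Symplectic.SteinStructure W₀)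
    (ι : Type) [Finite ι] (h : ι → Literature.Topology.FourManifolds.HandleAttachingMap 3 2 W₀),
    (Manifold.IsSmoothEmbedding (𝓡 4) (𝓡 4) ∞ e ∧ Manifold.IsSmoothEmbedding (𝓡∂ 4) (𝓡 4) ∞ j ∧
        Set.range j = (e '' Metric.ball (0 : EuclideanSpace ℝ (Fin 4)) 1)ᶜ ∧
        j '' ((𝓡∂ 4).boundary Δ) = e '' Metric.sphere (0 : EuclideanSpace ℝ (Fin 4)) 1) →
    Literature.Topology.FourManifolds.HandleAttachingMap.IsMultiAttachment h (𝓡∂ 4) Δ →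
    (∀ i, Literature.Geometry.Symplectic.IsLegendrianKnot T.J (h i).attachingCircle) →
    (∀ i, T.twisting (h i).attachingCircle (h i).attachingFraming = -1) →
    Nonempty (S.carrier ≃ₘ⟮𝓡 4, 𝓡 4⟯ Metric.sphere (0 : EuclideanSpace ℝ (Fin 5)) 1)

/-! ### The registered stubs -/

/-- STUB 1 [SCOPE: no 1-handles] (open problem; SHARED verbatim with crux `NoohNoOneHandles` of
route NoOneHandles, stmt-SmoothPoincare4-0378 = Kirby Problem 4.18 for homotopy spheres, and with
`stub_noOneHandles` of line round-trace-continuity — staffed once).  Every homotopy 4-sphere carries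
a Morse function without critical points of index 1; with `-f`: without index 3, i.e. the fake ball
`Σ ∖` 4-handle is a 2-HANDLEBODY.  Here the scope is FORCED: a certificate makes `Δ` Stein, and a
compact Stein domain is a 2-handlebody (Eliashberg–Gompf "only if", tree THEOREM
`Literature.Geometry.Symplectic.IsSteinDomain.isHandlebodyOfIndexLE_two`), so no Stein-certificate
line can say anything about a homotopy sphere needing 3-handles; this card does not attack the
stub (card §What it needs, "Scope item, NOT re-filed").  Why plausibly true: no homotopy 4-sphere
is known to need 1- or 3-handles; all standardised families were presented 3-handle-free; TOP trading
is available (Freedman).  Why it might fail: an exotic — or the standard! — `S⁴` with an obstruction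
to trading; the known obstructions (Yasui 2019 Thm 1.4) need `b₂⁺ > 1`.  Sources: Kirby1997
Problem 4.18; GompfStipsicz1999 §5.1; Yasui2019.  Size: open-problem (staffed through stmt-0378). -/
theorem stub_noOneHandles :
    ∀ S : Literature.Topology.FourManifolds.HomotopySphere 4, ∃ f : S.carrier → ℝ,
      Literature.Topology.FourManifolds.IsMorse (𝓡 4) f ∧
        Literature.Topology.FourManifolds.criticalSetOfIndex (𝓡 4) f 1 = ∅ := by
  sorry

/-- STUB 2 [Morse ⇒ KIRBY-PRESENTED FAKE BALL] (a theorem of handlebody theory; formal L–XL).  From a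
Morse function on `S` without index-1 critical points: (i) `-f` has a unique maximum `q` and no
index-3 points (components of sublevel sets are born at minima and merge only across 1-handles —
the LANDED `stub_morseFakeBall` of line round-trace-continuity, p89782, already delivers a Morse
ball `e : ℝ⁴ ↪ S` about `q` with `Δ_e := S ∖ e(B̊⁴) = {g ≤ 0}` presented in Morse form with
interior critical points of index `≤ 2`); (ii) give `Δ_e` its abstract structure of compact manifold
with boundary (`Δ`, `j` = inclusion; regular sublevel set of `g`, tree `RegularLevelSplitting` /
`BoundaryData`; `j(∂Δ) = {g = 0} = e(S³)`); (iii) REARRANGE `g|Δ` so that all index `≤ 1`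
critical values lie below all index-2 ones (Milnor 1965 Thm 4.8 / Lemma 2.9, tree named fact
`exists_isSelfIndexing_criticalSet_eq`; Kosinski VII §2) and cut in between: `W₀ := {g ≤ c}` is a
compact 1-handlebody (`IsHandlebodyOfIndexLE 3 1`, Morse function adapted to its boundary after
rescaling), orientable as a codimension-0 submanifold of the oriented `S`; (iv) passing the
index-2 critical points, all on one level after rearrangement, attaches 2-handles SIMULTANEOUSLY
along disjoint attaching maps in `∂W₀` (Milnor 1963 Thm 3.2 + §3 remark; Kosinski VI §6–8, VII
Prop 2.1): `Δ = W₀ ∪_{h₀} ⋃ H²` in the tree's sense `HandleAttachingMap.IsMultiAttachment h₀ (𝓡∂ 4) Δ`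
(bridge Morse-form ↔ Kosinski-form attachment: cf. tree `KnotTraceOfAttachment`,
`HandleSlabAttachment`, `HandleAttachingMapsExistence`).  Why plausibly true: a theorem.  Why it
might fail: it cannot mathematically; formally the Morse ↔ attaching-map bridge (iv) is the long
part (the one-handle case exists in tree for knot traces).  Sources: Milnor1963 §3; Milnor1965
§§3–4; Kosinski1993 VI–VII; GompfStipsicz1999 §4.2.  Size: L–XL formal. -/
theorem stub_kirbyFakeBall :
    ∀ S : Literature.Topology.FourManifolds.HomotopySphere 4,
      (∃ f : S.carrier → ℝ, Literature.Topology.FourManifolds.IsMorse (𝓡 4) f ∧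
          Literature.Topology.FourManifolds.criticalSetOfIndex (𝓡 4) f 1 = ∅) →
      ∃ (e : EuclideanSpace ℝ (Fin 4) → S.carrier) (Δ : Type) (_ : TopologicalSpace Δ) (_ : T2Space Δ)
        (_ : SecondCountableTopology Δ) (_ : ChartedSpace (EuclideanHalfSpace 4) Δ)
        (_ : IsManifold (𝓡∂ 4) ∞ Δ) (_ : CompactSpace Δ) (j : Δ → S.carrier)
        (W₀ : Type) (_ : TopologicalSpace W₀) (_ : T2Space W₀) (_ : SecondCountableTopology W₀)
        (_ : ChartedSpace (EuclideanHalfSpace 4) W₀) (_ : IsManifold (𝓡∂ 4) ∞ W₀) (_ : CompactSpace W₀)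
        (ι : Type) (_ : Finite ι) (h₀ : ι → Literature.Topology.FourManifolds.HandleAttachingMap 3 2 W₀),
        (Manifold.IsSmoothEmbedding (𝓡 4) (𝓡 4) ∞ e ∧ Manifold.IsSmoothEmbedding (𝓡∂ 4) (𝓡 4) ∞ j ∧
          Set.range j = (e '' Metric.ball (0 : EuclideanSpace ℝ (Fin 4)) 1)ᶜ ∧
          j '' ((𝓡∂ 4).boundary Δ) = e '' Metric.sphere (0 : EuclideanSpace ℝ (Fin 4)) 1) ∧
        Literature.Topology.FourManifolds.IsOrientable (𝓡∂ 4) W₀ ∧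
        Literature.Topology.FourManifolds.IsHandlebodyOfIndexLE 3 1 W₀ ∧
        Literature.Topology.FourManifolds.HandleAttachingMap.IsMultiAttachment h₀ (𝓡∂ 4) Δ :=
  -- CLOSED (wave 1, p137252 + Aux p137015): the tree theorem, verbatim signature.
  Summit.SmoothPoincare4.SmoothPoincare4.Theorems.OrigamiFoldExistence.BennequinDefectCertificates.stub_kirbyFakeBall

/-- STUB 3 [APEX — LEGENDRIAN NORMAL FORM OF FAKE-BALL DIAGRAMS] — HARDEST, the load-bearing open
statement of the line (the card's K1 typed PRESENTATION-RELATIVELY, as all three triagers asked: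
r2-1 doubt (1), r2-2 sharpen (a), r2-3 (1)).  For every homotopy 4-sphere `S`, every fake ball
`(e, Δ, j)` of `S` and every Kirby presentation of it — a compact orientable 1-handlebody `W₀`
(`≅ ♮ᵏ S¹ × B³`) and 2-handles attached simultaneously along `h₀` — there are a Stein structure `T`
on `W₀` and an ISOTOPY THROUGH LINKS IN `∂W₀` from the attaching link of `h₀` to the attaching link
of new attaching maps `h` (same index set: no births), carrying the handle framings of `h₀` to
framings homotopic to the handle framings of `h` (verbatim the hypotheses of the tree's ISO, so
`h` presents the SAME `Δ`), such that every new attaching circle is `T`-Legendrian and every new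
handle framing has twisting `-1` relative to the canonical (contact) framing: Akbulut–Matveyev
defect `Σᵢ max{fᵢ + 1 - tb, 0} = 0` with equality, i.e. the diagram is in Eliashberg–Gompf normal
form — a finite, checkable CERTIFICATE that `Δ` is Stein (E2), hence `𝔻⁴` (EL).  No handle is slid,
born or cancelled: the balanced presentation of the trivial group underlying the diagram is never
simplified (barrier A16 `StrictPropertyTwoRBarrier` not engaged in letter).
What it is, exactly (modulo STUBS 2, 4–6): `⟺ [3-handle-free homotopy 4-spheres are S⁴] ∧ Q`, with
`Q` its `S⁴`-instance "every 2-handlebody diagram of `B⁴` is framed-isotopic to a Stein diagram"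
— the empty-presentation loophole of the card's K1 (satisfied by `W := 𝔻⁴, ι := ∅` whenever
`Δ ≅ 𝔻⁴`) is closed: `Δ ≅ 𝔻⁴` does NOT give the conclusion for the given `(W₀, h₀)`.  Known cases:
`k = 0` (nothing to do); `k = 1` one-handle — `∂Δ = S³` makes the dual knot admit an `S¹ × S²`
surgery, so by Gabai's Property R (tree fact `isUnknot_of_isIntegralSurgery_zero`) the attaching
circle is isotopic to `S¹ × pt`, whose framings fall in two framed-isotopy classes (light bulb:
parity) both realised with twisting `-1` by a Legendrian `S¹ × pt` and its stabilisation
(Chen–Ding–Li 2013 Thm 1.1: Legendrian `S¹ × pt`-knots in `(S¹ × S², ξ_st)` are classified by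
`rot`; `tb` is not even an invariant there).  First open case `k = 2` (Akbulut–Kirby / Gompf 1991
ball diagrams; Property-2R territory).  The obstruction calculus below the full link is real and
exotica-free: for an essential class WITHOUT dual sphere the maximal twisting is FINITE
(Chen–Ding–Li 2013 Prop 4.2: `TW = 0` for Legendrian `(p, q)`-torus knots, `q ≥ 2`, in
`(S¹ × S², ξ_st)`), so the defect is a genuine computable quantity (card K2), and individual
certificates on named diagrams are theorems (card K3).  Why it might fail: (a) the zero-slack
conjunct is SPC4 for 3-handle-free spheres (an exotic 3-handle-free `S⁴` kills it and E);
(b) the exotica-free conjunct `Q` dies iff some diagram of the GENUINE ball admits no framed isotopy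
to Legendrian `tb - 1` form — forced, for AC-nontrivial spines such as AK(4), IF Stein structures on
`B⁴` are unique up to Stein homotopy (open; not in print — the bet of the line is that they are
not, and a certificate on such a diagram exhibits an exotic Stein homotopy class on `B⁴`); (c) a
`tb`-bound for one cancelling-type link class in `#²(S¹ × S²)` beating its prescribed framing would
refute `Q` cheaply (the card's cheapest falsifier; calibration = Legendrianise Gompf 1991's
`2·1h ∪ 2·2h` ball diagram and compute its defect, BEFORE any kit job).  Sources: Gompf1998 Thm 1.3,
§§1–2, §5; AkbulutMatveyev1998 §3; Eliashberg1990Stein; ChenDingLi2013 (arXiv:1310.1535) Thm 1.1,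
Prop 4.2; Gabai1987; Gompf1991Killing; AkbulutKirby1985; CieliebakEliashberg2012 (Weinstein
homotopies); Wendl2020 Cor 5.7 (deformation uniqueness only); Kirby1989 Ch. I §6.  Size: open-problem
(zero-slack carrier ∧ the open exotica-free `Q`). -/
theorem stub_legendrianNormalForm :
    ∀ (S : Literature.Topology.FourManifolds.HomotopySphere 4) (e : EuclideanSpace ℝ (Fin 4) → S.carrier)
      (Δ : Type) [TopologicalSpace Δ] [T2Space Δ] [SecondCountableTopology Δ]
      [ChartedSpace (EuclideanHalfSpace 4) Δ] [IsManifold (𝓡∂ 4) ∞ Δ] [CompactSpace Δ] (j : Δ → S.carrier)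
      (W₀ : Type) [TopologicalSpace W₀] [T2Space W₀] [SecondCountableTopology W₀]
      [ChartedSpace (EuclideanHalfSpace 4) W₀] [IsManifold (𝓡∂ 4) ∞ W₀] [CompactSpace W₀]
      (ι : Type) [Finite ι] (h₀ : ι → Literature.Topology.FourManifolds.HandleAttachingMap 3 2 W₀),
      (Manifold.IsSmoothEmbedding (𝓡 4) (𝓡 4) ∞ e ∧ Manifold.IsSmoothEmbedding (𝓡∂ 4) (𝓡 4) ∞ j ∧
          Set.range j = (e '' Metric.ball (0 : EuclideanSpace ℝ (Fin 4)) 1)ᶜ ∧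
          j '' ((𝓡∂ 4).boundary Δ) = e '' Metric.sphere (0 : EuclideanSpace ℝ (Fin 4)) 1) →
      Literature.Topology.FourManifolds.IsOrientable (𝓡∂ 4) W₀ →
      Literature.Topology.FourManifolds.IsHandlebodyOfIndexLE 3 1 W₀ →
      Literature.Topology.FourManifolds.HandleAttachingMap.IsMultiAttachment h₀ (𝓡∂ 4) Δ →
      ∃ (T : Literature.Geometry.Symplectic.SteinStructure W₀)
        (h : ι → Literature.Topology.FourManifolds.HandleAttachingMap 3 2 W₀)
        (Φ : Literature.Geometry.Symplectic.LinkIsotopyInBoundary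
          (fun i => (h₀ i).attachingCircle) fun i => (h i).attachingCircle)
        (νt : ι → ℝ → (Metric.sphere (0 : EuclideanSpace ℝ (Fin 2)) 1) → EuclideanSpace ℝ (Fin 4)),
        (∀ i, Literature.Geometry.Symplectic.IsFramingAlong (Φ.isotopy i) (h₀ i).attachingFraming (νt i)) ∧
        (∀ i, Literature.Geometry.Symplectic.FramingHomotopic (h i).attachingCircle (νt i 1)
          (h i).attachingFraming) ∧
        (Pairwise fun i i' => Disjoint (Set.range (h i).toFun) (Set.range (h i').toFun)) ∧
        (∀ i, Literature.Geometry.Symplectic.IsLegendrianKnot T.J (h i).attachingCircle) ∧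
        (∀ i, T.twisting (h i).attachingCircle (h i).attachingFraming = -1) := by
  sorry

/-- STUB 4 [CERTIFIED FAKE BALL ⇒ STANDARD SPHERE, under E2, EL, Γ₄ = 0] (known modulo its three
antecedents; formal L — the card's P1 + P2 in one provable piece).  Let the fake ball `(e, Δ, j)` of
the homotopy 4-sphere `S` be `W₀ ∪` 2-handles along `T`-Legendrian attaching circles with handle
framings of twisting `-1`, `T` a Stein structure on the compact `W₀`.  Then: (1) `Δ` is a Stein
domain — antecedent E2 (`Gompf1998_thm13_twoHandles`: Eliashberg's theorem part II, Gompf 1998 Thm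
1.3 (b)–(c) / Akbulut–Matveyev 1998 §3, VERBATIM its hypotheses); (2) `∂Δ ≅ S³`: the boundary
datum `b` of `Δ` (tree THEOREM `nonempty_boundaryData_holds 3 Δ`) composed with `j` is a smooth
embedding of the closed 3-manifold `b.carrier` with range `j(∂Δ) = e(S³) = range (e ∘ ι_{S³})`, and
two embeddings with the same range differ by a diffeomorphism (tree
`ExpHeight.exists_diffeomorph_comp_eq_of_range_eq`), so `b.carrier ≃ₘ S³`; (3) antecedent EL
(`Eliashberg1990_steinFilling_sphere_three`, Eliashberg 1990 Thm 5.1: Stein fillings of `S³` are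
`𝔻⁴`) gives `Ψ : Δ ≃ₘ 𝔻⁴`; (4) `jA := j ∘ Ψ⁻¹` and `jB := e|𝔻⁴` are two smooth closed-disc
embeddings covering `S` (`range j ∪ e(𝔻⁴) = S`), meeting only along their boundary spheres with the
same image `e(S³)` (`Diffeomorph.image_boundary` for `Ψ`; `range j ∩ e(B̊⁴) = ∅`), so `S` is a
twisted sphere `𝔻⁴ ∪_φ 𝔻⁴` (tree THEOREM `SchoenfliesTools.exists_isTwistedSphere`); (5) the Cerf
antecedent (body of route item `CerfGammaFour` = `cerf_twistedSphere_four`) gives `S ≅ S⁴` (tree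
`nonempty_diffeomorph_sphere_four_of_isTwistedSphere_of_cerf`).  The certificate lemma of the idea
(`legendrianCertificate_ball`, SketchIdeator4.lean, sorry-free) is steps (1)+(3).  Why plausibly
true: a theorem.  Why it might fail: it cannot mathematically; formally step (4) (restricting `e` to
the closed ball as a `𝓡∂ 4`-embedding, boundary bookkeeping) is the work.  Sources: Gompf1998 Thm
1.3; AkbulutMatveyev1998 §3; Eliashberg1990 Thm 5.1; Wendl2010 p. 6; KervaireMilnor1963 §1;
CerfDiffeoSphere1968; Milnor1965 §9.  Size: L formal. -/
theorem stub_certifiedFakeBallStandard :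
    Literature.Geometry.Symplectic.Gompf1998_thm13_twoHandles →
    Literature.Geometry.Symplectic.Eliashberg1990_steinFilling_sphere_three →
    (∀ [Fact (Literature.Topology.FourManifolds.isSmoothEmbedding_sphereInclusion' 3)] (φ : (Metric.sphere (0 : EuclideanSpace ℝ (Fin 4)) 1) ≃ₘ⟮𝓡 3, 𝓡 3⟯ (Metric.sphere (0 : EuclideanSpace ℝ (Fin 4)) 1)) (T : Literature.Topology.FourManifolds.TwistedSphere 3 φ), Nonempty (T.carrier ≃ₘ⟮𝓡 4, 𝓡 4⟯ Metric.sphere (0 : EuclideanSpace ℝ (Fin 5)) 1)) →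
    ∀ (S : Literature.Topology.FourManifolds.HomotopySphere 4) (e : EuclideanSpace ℝ (Fin 4) → S.carrier)
      (Δ : Type) [TopologicalSpace Δ] [T2Space Δ] [SecondCountableTopology Δ]
      [ChartedSpace (EuclideanHalfSpace 4) Δ] [IsManifold (𝓡∂ 4) ∞ Δ] [CompactSpace Δ] (j : Δ → S.carrier)
      (W₀ : Type) [TopologicalSpace W₀] [T2Space W₀] [SecondCountableTopology W₀]
      [ChartedSpace (EuclideanHalfSpace 4) W₀] [IsManifold (𝓡∂ 4) ∞ W₀] [CompactSpace W₀]
      (T : Literature.Geometry.Symplectic.SteinStructure W₀)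
      (ι : Type) [Finite ι] (h : ι → Literature.Topology.FourManifolds.HandleAttachingMap 3 2 W₀),
      (Manifold.IsSmoothEmbedding (𝓡 4) (𝓡 4) ∞ e ∧ Manifold.IsSmoothEmbedding (𝓡∂ 4) (𝓡 4) ∞ j ∧
          Set.range j = (e '' Metric.ball (0 : EuclideanSpace ℝ (Fin 4)) 1)ᶜ ∧
          j '' ((𝓡∂ 4).boundary Δ) = e '' Metric.sphere (0 : EuclideanSpace ℝ (Fin 4)) 1) →
      Literature.Topology.FourManifolds.HandleAttachingMap.IsMultiAttachment h (𝓡∂ 4) Δ →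
      (∀ i, Literature.Geometry.Symplectic.IsLegendrianKnot T.J (h i).attachingCircle) →
      (∀ i, T.twisting (h i).attachingCircle (h i).attachingFraming = -1) →
      Nonempty (S.carrier ≃ₘ⟮𝓡 4, 𝓡 4⟯ Metric.sphere (0 : EuclideanSpace ℝ (Fin 5)) 1) :=
  -- CLOSED (wave 1, p136483): the tree theorem, verbatim signature.
  Summit.SmoothPoincare4.SmoothPoincare4.Theorems.OrigamiFoldExistence.BennequinDefectCertificates.stub_certifiedFakeBallStandard

/-- STUB 5 [E2, NAMED LITERATURE FACT — Eliashberg's theorem part II: Stein structures extend over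
2-handles attached along Legendrian knots with framing `tb - 1`] (Gompf 1998 Thm 1.3 (b)–(c);
Akbulut–Matveyev 1998 Thm 2 (2), §3).  Statement = the tree's named fact
`Literature.Geometry.Symplectic.Gompf1998_thm13_twoHandles` itself (SteinTwoHandles.lean: reviewed under
D-0026 and KEPT as "irreducibly XL": holomorphic gluing of the model handle, `J`-convex surgery,
corner smoothing); registered so that the line's dependence on it is visible by name, exactly as
`stub_lawsonMichelsohn1984` of line round-trace-continuity; it closes by `exact …_holds` the day the
Literature discharges the fact (fact seat `provefact-…`), and is never this line's research content.
Why it might fail: a theorem in print; only as a FORMAL task (XL).  Sources: Gompf1998 Thm 1.3;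
AkbulutMatveyev1998 §3; Eliashberg1990Stein; CieliebakEliashberg2012.  Size: XL (literature debt). -/
theorem stub_eliashbergTwoHandles : Literature.Geometry.Symplectic.Gompf1998_thm13_twoHandles := by
  sorry

/-- STUB 6 [EL, NAMED LITERATURE FACT — Eliashberg: Stein fillings of `S³` are diffeomorphic to `𝔻⁴`]
(Eliashberg 1990 Thm 5.1 with Eliashberg 1992 Thm 2.1.1; Wendl 2010 p. 6).  Statement = the tree's
named fact `Literature.Geometry.Symplectic.Eliashberg1990_steinFilling_sphere_three` itself
(SteinFillingSphere.lean; also grounds ConvexBisection's `SphereSeamStandard` and SymplecticCap's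
`SteinSplitV2`); needs-fact marker as STUB 5, closes by `exact …_holds` on discharge (filling by
holomorphic discs: XL).  This is the crux's OWN endgame (convex filling of the contact `S³` ⇒ ball;
route header "SPC4(Σ) ⟺ Tr(Δ) meets the contact cone", Disproof §2) — the one place the line
touches the recogniser every line on E shares.  Why it might fail: a theorem in print; formal XL.
Sources: Eliashberg1990 Thm 5.1; Eliashberg1992 Thm 2.1.1; McDuff1990 Thm 1.7; Wendl2010.
Size: XL (literature debt). -/
theorem stub_eliashbergSteinFillingSphere :
    Literature.Geometry.Symplectic.Eliashberg1990_steinFilling_sphere_three := by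
  sorry

/-! ### Consistency: each named statement IS its registered stub (definitionally) -/

theorem noOneHandles_holds : NoOneHandles := stub_noOneHandles
theorem kirbyFakeBall_holds : KirbyFakeBall := stub_kirbyFakeBall
theorem legendrianNormalForm_holds : LegendrianNormalForm := stub_legendrianNormalForm
theorem certifiedFakeBallStandard_holds : CertifiedFakeBallStandard := stub_certifiedFakeBallStandard
theorem eliashbergTwoHandles_holds : Gompf1998_thm13_twoHandles := stub_eliashbergTwoHandles
theorem eliashbergSteinFillingSphere_holds : Eliashberg1990_steinFilling_sphere_three :=
  stub_eliashbergSteinFillingSphere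

/-! ### Name-keyed aliases of the six statements (the hypotheses of the composition) -/
namespace Registered

/-- Alias of `NoOneHandles` keyed by the registered stub name. -/
abbrev stub_noOneHandles : Prop := NoOneHandles
/-- Alias of `KirbyFakeBall` keyed by the registered stub name. -/
abbrev stub_kirbyFakeBall : Prop := KirbyFakeBall
/-- Alias of `LegendrianNormalForm` keyed by the registered stub name. -/
abbrev stub_legendrianNormalForm : Prop := LegendrianNormalForm
/-- Alias of `CertifiedFakeBallStandard` keyed by the registered stub name. -/
abbrev stub_certifiedFakeBallStandard : Prop := CertifiedFakeBallStandard
/-- Alias of E2 keyed by the registered stub name. -/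
abbrev stub_eliashbergTwoHandles : Prop := Literature.Geometry.Symplectic.Gompf1998_thm13_twoHandles
/-- Alias of EL keyed by the registered stub name. -/
abbrev stub_eliashbergSteinFillingSphere : Prop :=
  Literature.Geometry.Symplectic.Eliashberg1990_steinFilling_sphere_three

end Registered

/-! ### Glue (proved) -/

/-- Bookkeeping: the route item `CerfGammaFour` IS `CerfTwistedSphereFour` (definitionally). -/
theorem cerfGammaFour_iff : CerfGammaFour ↔ CerfTwistedSphereFour := Iff.rfl

/-- ISO between the apex and the certificate stub (pure logic over the PROVED tree theorem
`HandleAttachingMap.isMultiAttachment_of_linkIsotopyInBoundary_holds`, Kosinski VI §6): the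
Legendrian re-attachment produced by the normal form presents the same fake ball. [folklore] -/
theorem isMultiAttachment_of_normalForm
    {Δ : Type} [TopologicalSpace Δ] [ChartedSpace (EuclideanHalfSpace 4) Δ] [IsManifold (𝓡∂ 4) ∞ Δ]
    {W₀ : Type} [TopologicalSpace W₀] [T2Space W₀] [ChartedSpace (EuclideanHalfSpace 4) W₀]
    [IsManifold (𝓡∂ 4) ∞ W₀] [CompactSpace W₀] {ι : Type} [Finite ι]
    {h₀ h : ι → HandleAttachingMap 3 2 W₀}
    (Φ : LinkIsotopyInBoundary (fun i => (h₀ i).attachingCircle) fun i => (h i).attachingCircle)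
    (νt : ι → ℝ → 𝕊¹ → E4)
    (hfr : ∀ i, IsFramingAlong (Φ.isotopy i) (h₀ i).attachingFraming (νt i))
    (hend : ∀ i, FramingHomotopic (h i).attachingCircle (νt i 1) (h i).attachingFraming)
    (hdisj : Pairwise fun i i' => Disjoint (Set.range (h i).toFun) (Set.range (h i').toFun))
    (hatt : HandleAttachingMap.IsMultiAttachment h₀ (𝓡∂ 4) Δ) :
    HandleAttachingMap.IsMultiAttachment h (𝓡∂ 4) Δ :=
  Literature.Geometry.Symplectic.HandleAttachingMap.isMultiAttachment_of_linkIsotopyInBoundary_holds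
    W₀ Δ ι h₀ h Φ νt hfr hend hdisj hatt

/-- SCOPE ⟶ Kirby fake ball ⟶ Legendrian normal form ⟶ (ISO) ⟶ certified fake ball ⟶ `S ≅ S⁴`
(under E2, EL, Γ₄ = 0), for every `S : HomotopySphere 4`. -/
theorem nonempty_diffeomorph_sphere_of (h1 : NoOneHandles) (h2 : KirbyFakeBall)
    (h3 : LegendrianNormalForm) (h4 : CertifiedFakeBallStandard) (hE2 : Gompf1998_thm13_twoHandles)
    (hEL : Eliashberg1990_steinFilling_sphere_three) (hC : CerfTwistedSphereFour) (S : HomotopySphere 4) :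
    Nonempty (S.carrier ≃ₘ⟮𝓡 4, 𝓡 4⟯ 𝕊⁴) := by
  obtain ⟨e, Δ, _, _, _, _, _, _, j, W₀, _, _, _, _, _, _, ι, _, h₀, hfb, ho, hW, hatt⟩ := h2 S (h1 S)
  obtain ⟨T, h, Φ, νt, hfr, hend, hdisj, hleg, htw⟩ := h3 S e Δ j W₀ ι h₀ hfb ho hW hatt
  have hatt' : HandleAttachingMap.IsMultiAttachment h (𝓡∂ 4) Δ :=
    isMultiAttachment_of_normalForm Φ νt hfr hend hdisj hatt
  exact h4 hE2 hEL hC S e Δ j W₀ T ι h hfb hatt' hleg htw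

/-- The intrinsic fallback apex (card K1 in scope = SymplecticCap's stmt-0430 restricted to
Kirby-presented fake balls = route NoOneHandles' `NoohGscStandard` in Stein dress): Kirby-presented
fake balls of homotopy spheres are Stein.  Recorded (not registered) so that a lead who loses `Q`
can reshape the apex to it without re-planning; the normal form implies it under E2. -/
def KirbyFakeBallsStein : Prop :=
  ∀ (S : Literature.Topology.FourManifolds.HomotopySphere 4) (e : EuclideanSpace ℝ (Fin 4) → S.carrier)
    (Δ : Type) [TopologicalSpace Δ] [T2Space Δ] [SecondCountableTopology Δ]
    [ChartedSpace (EuclideanHalfSpace 4) Δ] [IsManifold (𝓡∂ 4) ∞ Δ] [CompactSpace Δ] (j : Δ → S.carrier)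
    (W₀ : Type) [TopologicalSpace W₀] [T2Space W₀] [SecondCountableTopology W₀]
    [ChartedSpace (EuclideanHalfSpace 4) W₀] [IsManifold (𝓡∂ 4) ∞ W₀] [CompactSpace W₀]
    (ι : Type) [Finite ι] (h₀ : ι → Literature.Topology.FourManifolds.HandleAttachingMap 3 2 W₀),
    (Manifold.IsSmoothEmbedding (𝓡 4) (𝓡 4) ∞ e ∧ Manifold.IsSmoothEmbedding (𝓡∂ 4) (𝓡 4) ∞ j ∧
        Set.range j = (e '' Metric.ball (0 : EuclideanSpace ℝ (Fin 4)) 1)ᶜ ∧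
        j '' ((𝓡∂ 4).boundary Δ) = e '' Metric.sphere (0 : EuclideanSpace ℝ (Fin 4)) 1) →
    Literature.Topology.FourManifolds.IsOrientable (𝓡∂ 4) W₀ →
    Literature.Topology.FourManifolds.IsHandlebodyOfIndexLE 3 1 W₀ →
    Literature.Topology.FourManifolds.HandleAttachingMap.IsMultiAttachment h₀ (𝓡∂ 4) Δ →
    Literature.Geometry.Symplectic.IsSteinDomain Δ

/-- The normal form implies the intrinsic fallback apex, under E2 (pure logic + ISO). [folklore] -/
theorem kirbyFakeBallsStein_of_normalForm (h3 : LegendrianNormalForm) (hE2 : Gompf1998_thm13_twoHandles) :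
    KirbyFakeBallsStein := by
  intro S e Δ _ _ _ _ _ _ j W₀ _ _ _ _ _ _ ι _ h₀ hfb ho hW hatt
  obtain ⟨T, h, Φ, νt, hfr, hend, hdisj, hleg, htw⟩ := h3 S e Δ j W₀ ι h₀ hfb ho hW hatt
  exact hE2 W₀ Δ T ι h (isMultiAttachment_of_normalForm Φ νt hfr hend hdisj hatt) hleg htw

/-! ### The composition: the six stubs and the route items `RoundSphereIsOrigamiFold` (stmt-7845,
PROVED) and `CerfGammaFour` (stmt-8758) imply the crux, by name -/

/-- `OrigamiFoldExistence` from the registered stubs still OPEN and the route's items, by name (pure logic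
+ PROVED tree theorems; no `sorry` outside `stub_*`): a smooth `M ≃ₕ S⁴` is compact
(`compactSpace_of_homotopyEquiv_sphere_four_holds`) and orientable
(`isOrientable_of_homotopyEquiv_sphere_four_holds`), hence a `HomotopySphere 4`; the glue gives
`M ≅ S⁴`; transport the fold data of `S⁴` (`Negative.foldData_transport`, p72874; the route item
`RoundSphereIsOrigamiFold` IS the fold data at `S⁴`, definitionally). -/
theorem OrigamiFoldExistence_of (h1 : Registered.stub_noOneHandles)
    (h3 : Registered.stub_legendrianNormalForm)
    (h5 : Registered.stub_eliashbergTwoHandles) (h6 : Registered.stub_eliashbergSteinFillingSphere)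
    (hR : RoundSphereIsOrigamiFold) (hC : CerfGammaFour) :
    OrigamiFoldExistence := by
  -- STUB 2 and STUB 4 are DISCHARGED inside the proof (tree theorems p137252 / p136483, r2).
  have h2 : Registered.stub_kirbyFakeBall := kirbyFakeBall_holds
  have h4 : Registered.stub_certifiedFakeBallStandard := certifiedFakeBallStandard_holds
  intro M _ _ _ _ _ hM
  haveI : CompactSpace M :=
    Literature.Topology.FourManifolds.compactSpace_of_homotopyEquiv_sphere_four_holds M hM
  obtain ⟨o⟩ :=
    Literature.Topology.FourManifolds.isOrientable_of_homotopyEquiv_sphere_four_holds M hM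
  obtain ⟨Ψ⟩ : Nonempty (M ≃ₘ⟮𝓡 4, 𝓡 4⟯ 𝕊⁴) :=
    nonempty_diffeomorph_sphere_of h1 h2 h3 h4 h5 h6 (cerfGammaFour_iff.1 hC) ⟨M, o, ⟨hM⟩⟩
  exact Summit.SmoothPoincare4.SmoothPoincare4.Theorems.OrigamiFoldExistence.Negative.foldData_transport Ψ hR

/-- Wiring check: the registered stubs feed `OrigamiFoldExistence_of` as stated. -/
example (hR : RoundSphereIsOrigamiFold) (hC : CerfGammaFour) : OrigamiFoldExistence :=
  OrigamiFoldExistence_of stub_noOneHandles stub_legendrianNormalForm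
    stub_eliashbergTwoHandles stub_eliashbergSteinFillingSphere hR hC

end Summit.SmoothPoincare4.SmoothPoincare4.Cruxes.OrigamiFoldExistence.BennequinDefectCertificates

end
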